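import Summits.ABC.IUTFork.FreeProSigmaUniqueRootsNoGo
import HarnessLib

/-!
# The typed right-hand side of [AbsTopII] Cor. 3.3 (ii) is EMPTY for EVERY `Σ` holding two primes

Cell `abc-iut` (run/shared/lean/pub/abc-iut/), layers L4/L5 — PROOF-ONLY sequel (no definitions, no
named facts) of `SemiEllipticDoubleCoverSubgroupsEmpty.lean` (★ p497668, abc-iut-f-052 g10) over
`FreeProSigmaUniqueRootsNoGo.lean` (★ p497997, abc-iut-L4-t17 g10): the general-`Σ` / any-index
successor named by abc-iut-L4-t17 (STATUS 2026-08-27T04:51:56Z) for the f-052 lineage; finding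
T1g11-F1 (abc-iut-L5-t1) dossier p493804 · p495314 · p497668 · p497997 · p499351.

[AbsTopII] Cor. 3.3 (ii) p. 68 (Mochizuki, *Topics in Absolute Anabelian Geometry II*, lit key
`paper:url-585b8d0ad0d9`): "the collection of open subgroups `J ⊆ Π_C` of index `2` such that
`J ∩ Δ_C` is torsion-free [i.e., the covering determined by `J` is a scheme — cf. [AbsTopI], Lemma 4.1,
(iv)]"; typed (F-0234, DEFS-frozen) as `AbsTopII.semiEllipticDoubleCoverSubgroups C :=
{J | IsOpen J ∧ J.index = 2 ∧ IsMulTorsionFree ↥(J ⊓ Δ_C)}` with Mathlib's UNIQUE-ROOTS class.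
p497668 showed this collection EMPTY when some open `P ⊆ Π_C` has `P ∩ Δ_C` free pro-`Σ` of rank `≥ 2`
with `2, 3 ∈ Σ` (every index-`≤ 2` subgroup of such a group surjects onto `S₃`).  With p497997's
`not_isMulTorsionFree_of_isOpen_of_isFreeProOn` (Schreier + the wreath-product witness
`(ℤ/p → ℤ/q) ⋊ ℤ/p`) the hypothesis «`2, 3 ∈ Σ`» and the index bookkeeping both disappear:
* **`not_isMulTorsionFree_inf_geom_of_isOpen_of_isFreeProOn`** — for `C : FundamentalExtension` with an
  open `P ⊆ Π_C` whose `P ∩ Δ_C` is free pro-`Σ` of rank `≥ 2`, and ANY two primes `p ≠ q` in `Σ`, NO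
  open `J ⊆ Π_C` — of any index — has `IsMulTorsionFree ↥(J ⊓ Δ_C)`: `J ∩ (P ∩ Δ_C)` is OPEN in the
  free pro-`Σ` group `P ∩ Δ_C`, so it fails unique roots (p497997), and it injects into `J ∩ Δ_C`
  (`Function.Injective.isMulTorsionFree`);
* **`semiEllipticDoubleCoverSubgroups_eq_empty_of_isFreeProOn_of_prime_ne`** — hence
  `semiEllipticDoubleCoverSubgroups C = ∅` for every such `Σ ⊇ {p, q}`;
* `semiEllipticDoubleCoverSubgroups_eq_empty_of_isFreeProOn_proOmissive` — in particular for every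
  PRO-OMISSIVE `Σ = Primes ∖ {ℓ}` ([AbsTopI] Def. 1.1 (iii)), including `ℓ ∈ {2, 3}` where p497668's
  `S₃` argument is silent;
(p497668's own statement — the instance `p = 2, q = 3` — is importable from its module and is not
re-derived here: gate dedup.)
READING (numbers, not adjectives): the RHS-EMPTY half of T1g11-F1 now has the same scope as the
`htf`-UNSATISFIABLE half (p497997): `|Σ ∩ Primes| ≥ 2`; for `Σ = {ℓ}` (free pro-`ℓ`, where unique roots
hold) nothing is claimed.  HONEST FRAMING: elementary (pro)finite group theory; empty AS TYPED at OUR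
predicate, not a statement about print (print's collection contains `Π_X` and is non-empty, [AbsTopII]
Rmk. 3.1.1 p. 65); the print-faithful successors (`semiEllipticDoubleCoverSubgroupsTF`,
`EllipticCuspidalizationTF`) are unaffected; nothing here bears on [IUTchIII] Cor. 3.12; typed ≠ proved
elsewhere.
-/

noncomputable section

open Topology

namespace Summit.ABC.IUTFork

open Literature.AnabelianGeometry.AbsoluteAnabelian AbsTopII

universe u

variable (C : FundamentalExtension.{u})

/-- **No open `J ⊆ Π_C` has `J ∩ Δ_C` with unique roots** once some open `P ⊆ Π_C` has `P ∩ Δ_C`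
free pro-`Σ` of rank `≥ 2` ([AbsTopI] Lem. 4.5 (i) vocabulary `IsFreeProOn`; print: `P = Π_X`, the
double covering of the semi-elliptic core by the once-punctured elliptic curve, [AbsTopII] Rmk. 3.1.1)
and `Σ` holds two distinct primes `p ≠ q`: `J ∩ P ∩ Δ_C` is an OPEN subgroup of `P ∩ Δ_C`, hence not
`IsMulTorsionFree` (`not_isMulTorsionFree_of_isOpen_of_isFreeProOn`, p497997: Schreier + the wreath
product `(ℤ/p → ℤ/q) ⋊ ℤ/p`), and it injects into `J ∩ Δ_C`.  No index hypothesis on `J`.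
[cite: MochizukiAbsTopII2013, Cor 3.3 (ii) p.68] -/
theorem not_isMulTorsionFree_inf_geom_of_isOpen_of_isFreeProOn (P : Subgroup C.arith)
    (hP : IsOpen (P : Set C.arith)) {S : Set ℕ} {n : ℕ} {gens : Fin n → ↥(P ⊓ C.geom)}
    (hfree : IsFreeProOn ↥(P ⊓ C.geom) S gens) (hn : 2 ≤ n) {p q : ℕ} (hp : p.Prime)
    (hq : q.Prime) (hpq : p ≠ q) (hpS : p ∈ S) (hqS : q ∈ S) (J : Subgroup C.arith)
    (hJ : IsOpen (J : Set C.arith)) : ¬ IsMulTorsionFree ↥(J ⊓ C.geom) := by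
  intro htf
  haveI : CompactSpace ↥(P ⊓ C.geom) := compactSpace_inf_geom C P hP
  -- `H := J ∩ (P ∩ Δ_C)` is OPEN in the free pro-`Σ` group `P ∩ Δ_C`
  have hHopen :
      IsOpen ((J.subgroupOf (P ⊓ C.geom) : Subgroup ↥(P ⊓ C.geom)) : Set ↥(P ⊓ C.geom)) := by
    have hset : ((J.subgroupOf (P ⊓ C.geom) : Subgroup ↥(P ⊓ C.geom)) : Set ↥(P ⊓ C.geom)) =
        Subtype.val ⁻¹' (J : Set C.arith) := by
      ext z; rfl
    rw [hset]
    exact hJ.preimage continuous_subtype_val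
  -- `H ↪ J ∩ Δ_C`, so unique roots descend from `J ∩ Δ_C` to `H`
  let ι : ↥(J.subgroupOf (P ⊓ C.geom)) →* ↥(J ⊓ C.geom) :=
    MonoidHom.codRestrict ((P ⊓ C.geom).subtype.comp (J.subgroupOf (P ⊓ C.geom)).subtype)
      (J ⊓ C.geom)
      (fun z => Subgroup.mem_inf.mpr
        ⟨Subgroup.mem_subgroupOf.mp z.2, (Subgroup.mem_inf.mp z.1.2).2⟩)
  have hι : Function.Injective ι := by
    intro z w hzw
    apply Subtype.ext
    apply Subtype.ext
    exact congrArg (fun v : ↥(J ⊓ C.geom) => (v : C.arith)) hzw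
  haveI : IsMulTorsionFree ↥(J.subgroupOf (P ⊓ C.geom)) := Function.Injective.isMulTorsionFree ι hι
  exact not_isMulTorsionFree_of_isOpen_of_isFreeProOn hfree hn hp hq hpq hpS hqS
    (J.subgroupOf (P ⊓ C.geom)) hHopen ‹_›

/-- **The typed RHS of [AbsTopII] Cor. 3.3 (ii) is EMPTY for every `Σ` with two primes**: if some open
`P ⊆ Π_C` has `P ∩ Δ_C` free pro-`Σ` of rank `≥ 2` and `p ≠ q` are primes in `Σ`, then
`semiEllipticDoubleCoverSubgroups C = ∅` — the general-`Σ` / index-free successor of p497668's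
`semiEllipticDoubleCoverSubgroups_eq_empty_of_isFreeProOn` (there: `2, 3 ∈ Σ`, via `S₃`).
[cite: MochizukiAbsTopII2013, Cor 3.3 (ii) p.68] -/
theorem semiEllipticDoubleCoverSubgroups_eq_empty_of_isFreeProOn_of_prime_ne (P : Subgroup C.arith)
    (hP : IsOpen (P : Set C.arith)) {S : Set ℕ} {n : ℕ} {gens : Fin n → ↥(P ⊓ C.geom)}
    (hfree : IsFreeProOn ↥(P ⊓ C.geom) S gens) (hn : 2 ≤ n) {p q : ℕ} (hp : p.Prime)
    (hq : q.Prime) (hpq : p ≠ q) (hpS : p ∈ S) (hqS : q ∈ S) :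
    semiEllipticDoubleCoverSubgroups C = ∅ := by
  ext J
  simp only [Set.mem_empty_iff_false, iff_false]
  rintro ⟨hJopen, -, htf⟩
  exact not_isMulTorsionFree_inf_geom_of_isOpen_of_isFreeProOn C P hP hfree hn hp hq hpq hpS hqS J
    hJopen htf

/-- The PRO-OMISSIVE case `Σ = Primes ∖ {ℓ}` of [AbsTopI] Def. 1.1 (iii): if some open `P ⊆ Π_C` has
`P ∩ Δ_C` free pro-`(Primes ∖ {ℓ})` of rank `≥ 2`, then `semiEllipticDoubleCoverSubgroups C = ∅` —
including `ℓ ∈ {2, 3}`, where the `S₃` route of p497668 is silent (two of `2, 3, 5` always survive).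
[cite: MochizukiAbsTopI2012, Def 1.1 (iii) p.10] -/
theorem semiEllipticDoubleCoverSubgroups_eq_empty_of_isFreeProOn_proOmissive {ℓ : ℕ}
    (P : Subgroup C.arith) (hP : IsOpen (P : Set C.arith)) {n : ℕ} {gens : Fin n → ↥(P ⊓ C.geom)}
    (hfree : IsFreeProOn ↥(P ⊓ C.geom) {r | r.Prime ∧ r ≠ ℓ} gens) (hn : 2 ≤ n) :
    semiEllipticDoubleCoverSubgroups C = ∅ := by
  by_cases h2 : ℓ = 2
  · exact semiEllipticDoubleCoverSubgroups_eq_empty_of_isFreeProOn_of_prime_ne C P hP hfree hn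
      Nat.prime_three Nat.prime_five (by decide) ⟨Nat.prime_three, by omega⟩ ⟨Nat.prime_five, by omega⟩
  by_cases h3 : ℓ = 3
  · exact semiEllipticDoubleCoverSubgroups_eq_empty_of_isFreeProOn_of_prime_ne C P hP hfree hn
      Nat.prime_two Nat.prime_five (by decide) ⟨Nat.prime_two, by omega⟩ ⟨Nat.prime_five, by omega⟩
  · exact semiEllipticDoubleCoverSubgroups_eq_empty_of_isFreeProOn_of_prime_ne C P hP hfree hn
      Nat.prime_two Nat.prime_three (by decide) ⟨Nat.prime_two, fun h' => h2 h'.symm⟩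
      ⟨Nat.prime_three, fun h' => h3 h'.symm⟩

end Summit.ABC.IUTFork

end
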